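import Summits.CriticalPhenomena.SAWScalingLimit.Theorems.BoundaryClosureNegative_Walks

/-!
# Negative knowledge on crux `BoundaryClosure` — the corridor refutation of `HexObservableLimit`, part 8: compactness and the limits of the marked mid-edges; peeling one vertex attached through a single neighbour (the parafermionic observables agree up to `x e^{-iσθ}`).

Support for `SAWDefectDecoherenceHexObservableLimitRefutation.lean` (item stmt-CriticalPhenomena-5420, the conclusion of
crux `BoundaryClosure`, stmt-CriticalPhenomena-8536). Everything proved. [folklore]
-/

noncomputable section

open Set Filter Topology Complex
open Literature.Probability.RandomPlanarGeometry
open UpperHalfPlane (upperHalfPlaneSet)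
open Literature.Probability.LatticeModels Literature.Probability.RandomPlanarGeometry.SAW

namespace Summit.CriticalPhenomena.SAWScalingLimit.Theorems.BoundaryClosure.Negative

/-! ### Compactness, limits of the marked mid-edges -/

/-- **Compact subsets of the half-disc are thick**: norms `≤ 1 - ε` and heights `≥ ε`. [folklore] -/
theorem exists_thick_of_isCompact {K : Set ℂ} (hK : IsCompact K) (hKD : K ⊆ HD) :
    ∃ ε : ℝ, 0 < ε ∧ ε ≤ 1 ∧ ∀ z ∈ K, ‖z‖ ≤ 1 - ε ∧ ε ≤ z.im := by
  rcases K.eq_empty_or_nonempty with rfl | hne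
  · exact ⟨1, one_pos, le_rfl, fun z hz => hz.elim⟩
  · have hcont : ContinuousOn (fun z : ℂ => min (1 - ‖z‖) z.im) K :=
      ((continuous_const.sub continuous_norm).min Complex.continuous_im).continuousOn
    obtain ⟨z₀, hz₀, hmin⟩ := hK.exists_isMinOn hne hcont
    have h0 : 0 < min (1 - ‖z₀‖) z₀.im := by
      have := hKD hz₀
      exact lt_min (by linarith [this.1]) this.2
    refine ⟨min (min (1 - ‖z₀‖) z₀.im) 1, lt_min h0 one_pos, min_le_right _ _, fun z hz => ?_⟩
    have hz' : min (1 - ‖z₀‖) z₀.im ≤ min (1 - ‖z‖) z.im := hmin hz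
    constructor
    · have h1 : min (min (1 - ‖z₀‖) z₀.im) 1 ≤ 1 - ‖z‖ :=
        (min_le_left _ _).trans (hz'.trans (min_le_left _ _))
      linarith
    · exact (min_le_left _ _).trans (hz'.trans (min_le_right _ _))

/-! ### The marked points: limits of the rescaled root and normalisation mid-edges -/

/-- The midpoint of the root edge at cell `n` is `(n + 5/4) + (√3/4) i`. [folklore] -/
theorem hexMidpoint_aEdge (n : ℤ) :
    hexMidpoint (aEdge n) = ((n : ℝ) + 5 / 4 : ℝ) + (Real.sqrt 3 / 4 : ℝ) * Complex.I := by
  unfold aEdge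
  rw [hexMidpoint_mk]
  apply Complex.ext
  · simp only [Complex.add_re, Complex.div_ofNat_re, re_hexCenter_fj, Complex.ofReal_re,
      Complex.mul_re, Complex.I_re, Complex.ofReal_im, Complex.I_im]
    push_cast; ring
  · simp only [Complex.add_im, Complex.div_ofNat_im, im_hexCenter_fj, Complex.ofReal_im,
      Complex.mul_im, Complex.I_re, Complex.ofReal_re, Complex.I_im]
    rw [show (2 * n + 2) % 2 = 0 by omega, show (2 * n + 1) % 2 = 1 by omega]
    push_cast; ring

/-- The midpoint of the normalisation edge is `1/2`. [folklore] -/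
theorem hexMidpoint_bEdge : hexMidpoint bEdge = ((1 / 2 : ℝ) : ℂ) := by
  unfold bEdge
  rw [hexMidpoint_mk]
  apply Complex.ext
  · simp only [Complex.add_re, Complex.div_ofNat_re, re_hexCenter_fj, Complex.ofReal_re]
    push_cast; ring
  · simp only [Complex.add_im, Complex.div_ofNat_im, im_hexCenter_fj, Complex.ofReal_im]
    rw [show (0:ℤ) % 2 = 0 by omega, show (1:ℤ) % 2 = 1 by omega]
    push_cast; ring

/-- A real limit: `δ ↦ δ (n δ + 5/4) → p` along `δ → 0⁺` when `|δ n δ - p| ≤ δ`. [folklore] -/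
theorem tendsto_mul_cell {n : ℝ → ℝ} {p : ℝ} (h : ∀ δ : ℝ, 0 < δ → |δ * n δ - p| ≤ δ) :
    Filter.Tendsto (fun δ : ℝ => δ * (n δ + 5 / 4)) (nhdsWithin 0 (Set.Ioi 0)) (nhds p) := by
  have h0 : Filter.Tendsto (fun δ : ℝ => δ) (nhdsWithin 0 (Set.Ioi 0)) (nhds 0) :=
    tendsto_nhdsWithin_of_tendsto_nhds Filter.tendsto_id
  rw [Metric.tendsto_nhds]
  intro ε hε
  have hev : ∀ᶠ δ : ℝ in nhdsWithin 0 (Set.Ioi 0), 0 < δ ∧ δ < ε / 4 := by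
    have h1 : ∀ᶠ δ : ℝ in nhdsWithin 0 (Set.Ioi 0), 0 < δ := eventually_nhdsWithin_of_forall fun x hx => hx
    have h2 : ∀ᶠ δ : ℝ in nhdsWithin 0 (Set.Ioi 0), δ < ε / 4 := by
      have := (Metric.tendsto_nhds.1 h0) (ε / 4) (by positivity)
      refine this.mono fun x hx => ?_
      rw [Real.dist_eq, sub_zero] at hx
      exact (le_abs_self _).trans_lt hx
    exact h1.and h2
  refine hev.mono fun δ ⟨hδ0, hδε⟩ => ?_
  have := h δ hδ0
  rw [Real.dist_eq]
  calc |δ * (n δ + 5 / 4) - p| = |(δ * n δ - p) + δ * (5 / 4)| := by ring_nf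
    _ ≤ |δ * n δ - p| + |δ * (5 / 4)| := abs_add_le _ _
    _ ≤ δ + δ * (5 / 4) := by rw [abs_of_pos (by positivity : (0:ℝ) < δ * (5 / 4))]; linarith
    _ < ε := by linarith

/-- **The rescaled root mid-edge converges to the marked point** `p` when the root cell `n δ`
satisfies `|δ n δ - p| ≤ δ`. [folklore] -/
theorem tendsto_smul_midpoint_aEdge {n : ℝ → ℤ} {p : ℝ}
    (h : ∀ δ : ℝ, 0 < δ → |δ * n δ - p| ≤ δ) :
    Filter.Tendsto (fun δ : ℝ => (δ : ℂ) * hexMidpoint (aEdge (n δ))) (nhdsWithin 0 (Set.Ioi 0))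
      (nhds ((p : ℝ) : ℂ)) := by
  have e : (fun δ : ℝ => (δ : ℂ) * hexMidpoint (aEdge (n δ))) =
      fun δ : ℝ => ((δ * ((n δ : ℝ) + 5 / 4) : ℝ) : ℂ) + ((δ * (Real.sqrt 3 / 4) : ℝ) : ℂ) * Complex.I := by
    funext δ; rw [hexMidpoint_aEdge]; push_cast; ring
  rw [e, show ((p : ℝ) : ℂ) = (p : ℂ) + ((0 : ℝ) : ℂ) * Complex.I by simp]
  refine Filter.Tendsto.add ?_ (Filter.Tendsto.mul_const _ ?_)
  · exact (Complex.continuous_ofReal.tendsto _).comp (tendsto_mul_cell (n := fun δ => (n δ : ℝ)) h)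
  · refine (Complex.continuous_ofReal.tendsto _).comp ?_
    have h0 : Filter.Tendsto (fun δ : ℝ => δ) (nhdsWithin 0 (Set.Ioi 0)) (nhds 0) :=
      tendsto_nhdsWithin_of_tendsto_nhds Filter.tendsto_id
    simpa using h0.mul_const (Real.sqrt 3 / 4)

/-- **The rescaled normalisation mid-edge converges to `0`.** [folklore] -/
theorem tendsto_smul_midpoint_bEdge :
    Filter.Tendsto (fun δ : ℝ => (δ : ℂ) * hexMidpoint bEdge) (nhdsWithin 0 (Set.Ioi 0)) (nhds 0) := by
  rw [hexMidpoint_bEdge]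
  have h0 : Filter.Tendsto (fun δ : ℝ => (δ : ℂ)) (nhdsWithin 0 (Set.Ioi 0)) (nhds 0) :=
    (Complex.continuous_ofReal.tendsto' 0 0 Complex.ofReal_zero).mono_left nhdsWithin_le_nhds
  simpa using h0.mul_const (((1 / 2 : ℝ) : ℂ))

/-- The junction cell: `|δ X - 1/2| ≤ δ`. [folklore] -/
theorem abs_Xc (δ : ℝ) (hδ : 0 < δ) : |δ * Xc δ - 1 / 2| ≤ δ := by
  have h := Xc_bounds δ
  rw [one_div_two_mul] at h
  have e : δ * δ⁻¹ = 1 := mul_inv_cancel₀ hδ.ne'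
  rw [abs_le]; constructor <;> nlinarith [h.1, h.2]

/-- The tip cell: `|δ T - 3/4| ≤ δ`. [folklore] -/
theorem abs_Tc (δ : ℝ) (hδ : 0 < δ) : |δ * Tc δ - 3 / 4| ≤ δ := by
  have h := Tc_bounds δ
  rw [three_div_four_mul] at h
  have e : δ * δ⁻¹ = 1 := mul_inv_cancel₀ hδ.ne'
  rw [abs_le]; constructor <;> nlinarith [h.1, h.2]


/-! ## Peeling one corridor vertex

If `w ∉ Λ` is attached to the domain `Λ` through a single neighbour `t ∈ Λ` (every other neighbour
of `w` lying outside `Λ' = insert w Λ`), then for the outer neighbour `u ∉ Λ'` of `w` the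
self-avoiding walks of `Λ'` from the boundary mid-edge `{u, w}` to a mid-edge `z ∌ w` correspond
bijectively (drop the first vertex) to the walks of `Λ` from the boundary mid-edge `{w, t}` to `z`;
lengths drop by one and windings by the constant first turning angle, so the parafermionic
observables agree up to the nonzero factor `x e^{-iσθ}`. -/

section Peel

/-- Moving the first point of a polyline along its first segment does not change the winding
(restated over `Polyline.winding`). [folklore] -/
theorem winding_cons_left_ray' {t : ℝ} (ht : 0 < t) (p q : ℂ) (L : List ℂ) :
    Polyline.winding ((q + t * (p - q)) :: q :: L) = Polyline.winding (p :: q :: L) := by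
  cases L with
  | nil => simp
  | cons r L => rw [Polyline.winding_cons_cons_cons, Polyline.winding_cons_cons_cons,
      HV.turning_left_ray ht]

/-- Consecutive pairs of a cons-cons list. [folklore] -/
theorem edges_cons_cons' (x y : HexVertex) (l : List HexVertex) :
    List.zipWith (fun a b => s(a, b)) (x :: y :: l) (x :: y :: l).tail =
      s(x, y) :: List.zipWith (fun a b => s(a, b)) (y :: l) (y :: l).tail := rfl

/-- **Structure of a walk from the boundary mid-edge `{u, w}` when `w` is attached only through `t`**:
it reads `w, t, …`. [folklore] -/
theorem verts_eq_of_attached {Λ : Finset HexVertex} {u w t : HexVertex} {z : Sym2 HexVertex}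
    (hu' : u ∉ insert w Λ) (hclosed : ∀ v ∈ insert w Λ, hexGraph.Adj w v → v = t) (hz : w ∉ z)
    (γ : HexMidEdgeSAW (insert w Λ) s(u, w) z) : ∃ rest : List HexVertex, γ.verts = w :: t :: rest := by
  have hne : γ.verts ≠ [] := fun h => hz (by rw [← γ.eq_of_nil h]; exact Sym2.mem_mk_right _ _)
  have hhead : γ.verts.head hne = w := γ.head_eq rfl hu' hne
  obtain ⟨v₁, L, hL⟩ := List.exists_cons_of_ne_nil hne
  have hv₁ : v₁ = w := by rw [← hhead]; simp [hL]
  subst hv₁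
  -- at least two vertices: otherwise the walk ends at `v₁ = w ∈ z`
  have hLne : L ≠ [] := by
    rintro rfl
    apply hz
    have := γ.getLast_mem v₁ (by rw [hL]; rfl)
    exact this
  obtain ⟨v₂, rest, rfl⟩ := List.exists_cons_of_ne_nil hLne
  -- the second vertex is a neighbour of `w` in the enlarged domain, hence `t`
  have hadj : hexGraph.Adj v₁ v₂ := by
    have hc := γ.isChain; rw [hL] at hc
    exact (List.isChain_cons_cons.1 hc).1
  have hv₂ : v₂ = t := hclosed v₂ (γ.subset v₂ (by rw [hL]; simp)) hadj
  exact ⟨rest, by rw [hL, hv₂]⟩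

/-- **Structure of a walk from the boundary mid-edge `{w, t}` of `Λ`** (`w ∉ Λ`): it reads `t, …`.
[folklore] -/
theorem verts_eq_of_boundary {Λ : Finset HexVertex} {w t : HexVertex} {z : Sym2 HexVertex}
    (hw : w ∉ Λ) (hz : w ∉ z) (γ : HexMidEdgeSAW Λ s(w, t) z) :
    ∃ rest : List HexVertex, γ.verts = t :: rest := by
  have hne : γ.verts ≠ [] := fun h => hz (by rw [← γ.eq_of_nil h]; exact Sym2.mem_mk_left _ _)
  have hhead : γ.verts.head hne = t := γ.head_eq rfl hw hne
  obtain ⟨v₁, L, hL⟩ := List.exists_cons_of_ne_nil hne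
  have hv₁ : v₁ = t := by rw [← hhead]; simp [hL]
  exact ⟨L, by rw [hL, hv₁]⟩

/-- **Peeling one vertex**: the parafermionic observables of `insert w Λ` from `{u, w}` and of `Λ`
from `{w, t}` agree up to the nonzero factor `x e^{-iσθ}`, `θ` the turning angle at `w`, at every
mid-edge not containing `w`. [folklore] -/
theorem observable_insert {Λ : Finset HexVertex} {u w t : HexVertex} {z : Sym2 HexVertex}
    (hw : w ∉ Λ) (hu : u ∉ Λ) (huw : u ≠ w) (hadj_uw : hexGraph.Adj u w) (hadj_wt : hexGraph.Adj w t)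
    (ht : t ∈ Λ) (hclosed : ∀ v ∈ insert w Λ, hexGraph.Adj w v → v = t) (hz : w ∉ z) (x σ : ℝ) :
    hexParafermionicObservable (insert w Λ) s(u, w) x σ z =
      ((x : ℂ) * Complex.exp (-Complex.I * σ *
        (turning (hexMidpoint s(u, w)) (hexCenter w) (hexCenter t) : ℝ))) *
        hexParafermionicObservable Λ s(w, t) x σ z := by
  have hu' : u ∉ insert w Λ := by rw [Finset.mem_insert, not_or]; exact ⟨huw, hu⟩
  have hut : u ≠ t := fun h => hu (h ▸ ht)
  have vEq := verts_eq_of_attached hu' hclosed hz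
  have vEq' := fun γ : HexMidEdgeSAW Λ s(w, t) z => verts_eq_of_boundary hw hz γ
  -- drop the first vertex
  let peel : HexMidEdgeSAW (insert w Λ) s(u, w) z → HexMidEdgeSAW Λ s(w, t) z := fun γ =>
    { verts := γ.verts.tail
      subset := fun v hv => by
        have hv' : v ∈ γ.verts := List.mem_of_mem_tail hv
        have hvΛ := γ.subset v hv'
        rw [Finset.mem_insert] at hvΛ
        rcases hvΛ with rfl | h
        · exfalso
          obtain ⟨rest, hr⟩ := vEq γ
          have hnd := γ.nodup
          rw [hr] at hnd hv
          simp only [List.tail_cons] at hv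
          exact (List.nodup_cons.1 hnd).1 hv
        · exact h
      nodup := γ.nodup.sublist (List.tail_sublist _)
      isChain := γ.isChain.tail
      head_mem := fun v hv => by
        obtain ⟨rest, hr⟩ := vEq γ
        rw [hr] at hv; simp only [List.tail_cons, List.head?_cons, Option.some.injEq] at hv
        rw [← hv]; exact Sym2.mem_mk_right _ _
      getLast_mem := fun v hv => by
        obtain ⟨rest, hr⟩ := vEq γ
        apply γ.getLast_mem v
        rw [hr] at hv ⊢
        simp only [List.tail_cons] at hv
        rw [List.getLast?_cons_cons]; exact hv
      eq_of_nil := fun h => by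
        obtain ⟨rest, hr⟩ := vEq γ
        rw [hr] at h; simp at h
      edges_nodup := fun _ => by
        obtain ⟨rest, hr⟩ := vEq γ
        have hnd := γ.edges_nodup (by rw [hr]; simp)
        rw [hr] at hnd ⊢
        simp only [List.tail_cons]
        rw [edges_cons_cons', List.cons_append, List.cons_append] at hnd
        exact (List.nodup_cons.1 hnd).2
      fst_mem := ⟨(SimpleGraph.mem_edgeSet hexGraph).2 hadj_wt, t, Sym2.mem_mk_right _ _, ht⟩ }
  -- prepend `w`
  let unpeel : HexMidEdgeSAW Λ s(w, t) z → HexMidEdgeSAW (insert w Λ) s(u, w) z := fun γ =>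
    { verts := w :: γ.verts
      subset := fun v hv => by
        rw [Finset.mem_insert]
        rcases List.mem_cons.1 hv with rfl | h
        · exact Or.inl rfl
        · exact Or.inr (γ.subset v h)
      nodup := List.nodup_cons.2 ⟨fun h => hw (γ.subset w h), γ.nodup⟩
      isChain := by
        obtain ⟨rest, hr⟩ := vEq' γ
        have hc := γ.isChain
        rw [hr] at hc ⊢
        exact List.IsChain.cons_cons hadj_wt hc
      head_mem := fun v hv => by
        simp only [List.head?_cons, Option.some.injEq] at hv
        rw [← hv]; exact Sym2.mem_mk_right _ _
      getLast_mem := fun v hv => by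
        obtain ⟨rest, hr⟩ := vEq' γ
        apply γ.getLast_mem v
        rw [hr] at hv ⊢
        rwa [List.getLast?_cons_cons] at hv
      eq_of_nil := fun h => by simp at h
      edges_nodup := fun _ => by
        obtain ⟨rest, hr⟩ := vEq' γ
        have hnd := γ.edges_nodup (by rw [hr]; simp)
        rw [hr] at hnd ⊢
        rw [edges_cons_cons', List.cons_append, List.nodup_cons]
        refine ⟨fun hmem => ?_, hnd⟩
        rw [List.cons_append, List.mem_cons, List.mem_append, List.mem_singleton] at hmem
        rcases hmem with h | h | h
        · have : u ∈ s(w, t) := by rw [← h]; exact Sym2.mem_mk_left _ _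
          rcases Sym2.mem_iff.1 this with h' | h'
          · exact huw h'
          · exact hut h'
        · have hw' : w ∈ t :: rest := forall_mem_of_mem_edges _ _ h w (Sym2.mem_mk_right _ _)
          exact hw (γ.subset w (by rw [hr]; exact hw'))
        · exact hz (by rw [← h]; exact Sym2.mem_mk_right _ _)
      fst_mem := ⟨(SimpleGraph.mem_edgeSet hexGraph).2 hadj_uw, w, Sym2.mem_mk_right _ _,
        Finset.mem_insert_self _ _⟩ }
  -- the bijection
  let e : HexMidEdgeSAW (insert w Λ) s(u, w) z ≃ HexMidEdgeSAW Λ s(w, t) z :=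
    { toFun := peel
      invFun := unpeel
      left_inv := fun γ => by
        apply HexMidEdgeSAW.ext
        obtain ⟨rest, hr⟩ := vEq γ
        show w :: γ.verts.tail = γ.verts
        rw [hr]; rfl
      right_inv := fun γ => HexMidEdgeSAW.ext rfl }
  -- weights scale by `x e^{-iσθ}`
  have weight_eq : ∀ γ : HexMidEdgeSAW Λ s(w, t) z, (unpeel γ).weight x σ =
      ((x : ℂ) * Complex.exp (-Complex.I * σ *
        (turning (hexMidpoint s(u, w)) (hexCenter w) (hexCenter t) : ℝ))) * γ.weight x σ := by
    intro γ
    obtain ⟨rest, hr⟩ := vEq' γ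
    have hlen : (unpeel γ).length = γ.length + 1 := by
      show (w :: γ.verts).length = γ.verts.length + 1; simp
    have hwind : (unpeel γ).winding =
        turning (hexMidpoint s(u, w)) (hexCenter w) (hexCenter t) + γ.winding := by
      show Polyline.winding (hexMidpoint s(u, w) :: (w :: γ.verts).map hexCenter ++ [hexMidpoint z]) =
        _ + Polyline.winding (hexMidpoint s(w, t) :: γ.verts.map hexCenter ++ [hexMidpoint z])
      rw [hr]
      simp only [List.map_cons, List.cons_append]
      rw [Polyline.winding_cons_cons_cons]
      congr 1
      have e : hexMidpoint s(w, t) = hexCenter t + (1 / 2 : ℝ) * (hexCenter w - hexCenter t) := by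
        rw [hexMidpoint_mk]; push_cast; ring
      rw [e]
      exact (winding_cons_left_ray' (t := 1 / 2) (by norm_num) _ _ _).symm
    unfold HexMidEdgeSAW.weight
    rw [hlen, hwind, pow_succ]
    push_cast
    rw [show -Complex.I * σ * ((turning (hexMidpoint s(u, w)) (hexCenter w) (hexCenter t) : ℂ) +
        (γ.winding : ℂ)) = -Complex.I * σ * (turning (hexMidpoint s(u, w)) (hexCenter w) (hexCenter t) : ℂ)
        + -Complex.I * σ * (γ.winding : ℂ) by ring, Complex.exp_add]
    ring
  -- sum over the bijection
  unfold hexParafermionicObservable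
  rw [Finset.mul_sum]
  refine Fintype.sum_equiv e _ _ fun γ => ?_
  have hγ : γ = unpeel (e γ) := (e.left_inv γ).symm
  conv_lhs => rw [hγ]
  exact weight_eq _

end Peel


end Summit.CriticalPhenomena.SAWScalingLimit.Theorems.BoundaryClosure.Negative
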